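import Literature.MathematicalPhysics.StatisticalMechanics.Theil2006DiscreteImbedding
import Literature.MathematicalPhysics.StatisticalMechanics.Theil2006LongRange
import HarnessLib

/-!
# Theil 2006, §2.3/§2.4: the short bonds lying in fewer than two unit simplices are controlled by
the defects — `#(𝒮₀ ∪ 𝒮₁) ≤ C #∂X` (p. 11) — and the printed (38)

Topic `Literature/MathematicalPhysics/StatisticalMechanics`; companion of `Theil2006.lean`
(`shortRangePairs = 𝒮`, `nbhd = 𝒩`, `defects = ∂X` for `y : X_N → ℝ²`),
`Theil2006DiscreteImbedding.lean` (Definition 2.6: `IsEquilateralSimplex α y 1 T` = "`T ∈ 𝒯₁(y)`";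
the hexagonal wheels `IsHexagonalNbhd` / `exists_isHexagonalNbhd` of particles of `X ∖ 𝒩(∂X)`,
Lemma 4.7) and `Theil2006LongRange.lean` ((38) summed over an arbitrary finite set of short bonds,
`exists_sum_abs_sub_renormalizedPotential_le`, whose docstring records that the count
`#(𝒮₀ ∪ 𝒮₁) ≤ C #∂X` was the missing half). Everything here is PROVED (no `sorry`, no named
fact; D-0026).

## Source, as printed (preprint p. 9 and pp. 11–12)

[p. 9] "We use the notion of equilateral simplices to define a further splitting of the set of
short range interactions `𝒮(y)` and long-range interactions `ℒ(y)`. For `j = 0, 1, 2` let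
`𝒮_j(y) := {p ∈ 𝒮(y) | there exists precisely j simplices T ∈ 𝒯₁ such that p ⊂ T}`, […]."
[p. 11] "The lower bound on the minimum distance (13) implies that `#(𝒮₀(y) + 𝒮₁(y)) ≤ C #∂X`.
Inequality (12) gives for each `p ∈ 𝒮(y)` the estimates
`|e_*(p) − e(p)| ≤ ⅙ Σ_{ξ ∈ A₂, |ξ| > 1} α((1 − α)|ξ|)⁻⁵ ≤ Cα` and
(38) `Σ_{p ∈ 𝒮₀ ∪ 𝒮₁} |e(p) − e_*(p)| ≤ Cα #∂X`."

## What is here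

* `Theil2006.unitSimplices α y` — `𝒯₁(y)` as a finset; `Theil2006.simplexCount α y x x'` — the
  number of unit simplices containing `{x, x'}`; `Theil2006.shortRangePairsWith α y j` — `𝒮_j(y)`;
  `Theil2006.defectNbhd α y` — `𝒩(∂X) = ∂X ∪ {neighbours of defects}`.
* `Theil2006.two_le_simplexCount` — **the geometric content**: a short bond `{x, x'}` with
  `x ∈ X ∖ 𝒩(∂X)` lies in (at least) the two unit simplices `{x, x', p₁}`, `{x, x', p₅}` of the
  hexagonal wheel around `x` (Lemma 4.7's wheel, `exists_isHexagonalNbhd`, under (13),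
  `0 < α ≤ 1/200`).
* `Theil2006.card_defectNbhd_le` — `#𝒩(∂X) ≤ 7 #∂X` ((18): at most six neighbours,
  `card_filter_shortRange_le_six`).
* `Theil2006.card_shortRangePairs_simplexCount_lt_two_le` — **`#(𝒮₀ ∪ 𝒮₁) ≤ 42 #∂X`**, and the
  printed form `Theil2006.card_shortRangePairsWith_zero_add_one_le`
  (`#𝒮₀ + #𝒮₁ ≤ 42 #∂X`). The paper's `C` is unspecified; ours is `42 = 6 · 7`.
* `Theil2006.exists_sum_abs_sub_le_card_defects` — **(38) as printed**:
  `Σ_{p ∈ 𝒮₀ ∪ 𝒮₁} |e(p) − e_*(p)| ≤ C α #∂X` with a universal `C`, for `0 < α ≤ 1/200` and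
  `V` satisfying (1)–(5).
* `Theil2006.apex_abstract`, `Theil2006.dist_lt_of_same_side`, `Theil2006.card_common_neighbours_le_two`,
  `Theil2006.simplexCount_le_two` — **the apex argument**: under (13) (`0 < α ≤ 1/20`) two
  particles forming near-unit triangles with the same bond on the same side are closer than
  `1 − α`, so a short bond has at most two common `𝒮`-neighbours and lies in at most two unit
  simplices; hence `Theil2006.shortRangePairs_eq_union` (**`𝒮 = 𝒮₀ ∪ 𝒮₁ ∪ 𝒮₂`**, the short-range
  half of "Proposition 2.8.1 implies `𝒫 = ⋃_j (𝒮_j ∪ ℒ_j)`", p. 9) and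
  `Theil2006.simplexCount_eq_two` (off `𝒩(∂X)` every short bond is in `𝒮₂`).
-/

noncomputable section

open scoped BigOperators
open Set Metric

namespace Literature.MathematicalPhysics.StatisticalMechanics

namespace Theil2006

variable {α : ℝ} {N : ℕ} {y : Fin N → Plane}

/-! ### `𝒯₁(y)`, `𝒮_j(y)` and `𝒩(∂X)` for finite configurations -/

section Defs

variable (α) (y)

open scoped Classical in
/-- **`𝒯₁(y)`** — the unit equilateral simplices of `y : X_N → ℝ²` (Definition 2.6, `λ = 1`:
three particles, all three pairs short bonds), as a finset.
[cite: Theil2006, §2.3 Definition 2.6 (preprint p. 8)] -/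
def unitSimplices : Finset (Finset (Fin N)) :=
  Finset.univ.filter fun T => IsEquilateralSimplex α y 1 T

/-- The number of unit simplices `T ∈ 𝒯₁(y)` with `{x, x'} ⊂ T`.
[cite: Theil2006, §2.3 (definition of 𝒮_j(y), preprint p. 9)] -/
def simplexCount (x x' : Fin N) : ℕ :=
  ((unitSimplices α y).filter fun T => x ∈ T ∧ x' ∈ T).card

/-- **`𝒮_j(y) := {p ∈ 𝒮(y) | there exist precisely j simplices T ∈ 𝒯₁ with p ⊂ T}`** (as
ordered pairs `x < x'`, like `shortRangePairs`). [cite: Theil2006, §2.3 (definition of 𝒮_j(y), preprint p. 9)] -/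
def shortRangePairsWith (j : ℕ) : Finset (Fin N × Fin N) :=
  (shortRangePairs α y).filter fun p => simplexCount α y p.1 p.2 = j

/-- The `𝒮`-neighbours of `x` (the finset `𝒩(x) ∖ {x}`). [cite: Theil2006, §2.1 (𝒩(x), preprint p. 4)] -/
def neighbours (x : Fin N) : Finset (Fin N) :=
  Finset.univ.filter fun x' => |dist (y x) (y x') - 1| ≤ α

open scoped Classical in
/-- **`𝒩(∂X)`** — the defects together with their `𝒮`-neighbours (the set off which Lemma 4.7
provides hexagonal wheels, "`x ∈ X ∖ 𝒩(∂X)`", p. 20). [cite: Theil2006, §4.2 Lemma 4.7 (preprint p. 20)] -/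
def defectNbhd : Finset (Fin N) :=
  defects α y ∪ (defects α y).biUnion fun b => neighbours α y b

end Defs

/-- Membership in `𝒯₁(y)`. [cite: Theil2006, §2.3 Definition 2.6 (preprint p. 8)] -/
theorem mem_unitSimplices_iff {T : Finset (Fin N)} :
    T ∈ unitSimplices α y ↔ IsEquilateralSimplex α y 1 T := by
  classical
  simp [unitSimplices]

/-- Membership in the neighbour finset. [cite: Theil2006, §2.1 (preprint p. 4)] -/
theorem mem_neighbours_iff {x x' : Fin N} : x' ∈ neighbours α y x ↔ IsShortRange α y x x' := by
  simp [neighbours, IsShortRange]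

/-- Membership in `𝒮_j(y)`. [cite: Theil2006, §2.3 (preprint p. 9)] -/
theorem mem_shortRangePairsWith_iff {j : ℕ} {p : Fin N × Fin N} :
    p ∈ shortRangePairsWith α y j ↔ p ∈ shortRangePairs α y ∧ simplexCount α y p.1 p.2 = j :=
  Finset.mem_filter

/-- **(18): at most six neighbours** under (13), `0 < α ≤ 1/50`.
[cite: Theil2006, §2.2 Proposition 2.3 (18) (preprint p. 7)] -/
theorem card_neighbours_le_six (hα : 0 < α) (hα' : α ≤ 1 / 50)
    (hsep : ∀ i j : Fin N, i ≠ j → 1 - α < dist (y i) (y j)) (x : Fin N) :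
    (neighbours α y x).card ≤ 6 :=
  card_filter_shortRange_le_six hα hα' y hsep x

/-- `#𝒩(∂X) ≤ 7 #∂X`. [cite: Theil2006, §2.2 Proposition 2.3 (18) (preprint p. 7); our count] -/
theorem card_defectNbhd_le (hα : 0 < α) (hα' : α ≤ 1 / 50)
    (hsep : ∀ i j : Fin N, i ≠ j → 1 - α < dist (y i) (y j)) :
    (defectNbhd α y).card ≤ 7 * (defects α y).card := by
  classical
  unfold defectNbhd
  refine (Finset.card_union_le _ _).trans ?_
  have h := Finset.card_biUnion_le (s := defects α y) (t := fun b => neighbours α y b)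
  have h6 : ∑ b ∈ defects α y, (neighbours α y b).card ≤ ∑ b ∈ defects α y, 6 :=
    Finset.sum_le_sum fun b _ => card_neighbours_le_six hα hα' hsep b
  rw [Finset.sum_const, smul_eq_mul] at h6
  omega

/-! ### A short bond off `𝒩(∂X)` lies in two unit simplices -/

/-- Three distinct particles, pairwise short bonds, form a unit simplex.
[cite: Theil2006, §2.3 Definition 2.6, case λ = 1 (preprint p. 8)] -/
theorem isEquilateralSimplex_one_triple {a b c : Fin N} (hab : a ≠ b) (hac : a ≠ c) (hbc : b ≠ c)
    (h₁ : IsShortRange α y a b) (h₂ : IsShortRange α y a c) (h₃ : IsShortRange α y b c) :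
    IsEquilateralSimplex α y 1 ({a, b, c} : Finset (Fin N)) := by
  rw [isEquilateralSimplex_one_iff]
  refine ⟨Finset.card_eq_three.2 ⟨a, b, c, hab, hac, hbc, rfl⟩, ?_⟩
  intro u hu v hv huv
  simp only [Finset.mem_insert, Finset.mem_singleton] at hu hv
  rcases hu with rfl | rfl | rfl <;> rcases hv with rfl | rfl | rfl
  all_goals first | exact absurd rfl huv | exact h₁ | exact h₂ | exact h₃ | exact h₁.symm |
    exact h₂.symm | exact h₃.symm

/-- **A short bond `{x, x'}` with `x ∈ X ∖ 𝒩(∂X)` lies in at least two unit simplices** — the two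
triangles `{x, x', p₁}`, `{x, x', p₅}` of the hexagonal wheel `x' = p₀, p₁, …, p₅` around `x`
(Lemma 4.7; (13), `0 < α ≤ 1/200`). [cite: Theil2006, §4.2 Lemma 4.7 (preprint p. 20) with §2.3 (𝒮_j, preprint p. 9)] -/
theorem two_le_simplexCount (hα : 0 < α) (hα' : α ≤ 1 / 200)
    (hsep : ∀ i j : Fin N, i ≠ j → 1 - α < dist (y i) (y j)) {x x' : Fin N}
    (hx : x ∉ defectSet α y) (hN : ∀ ⦃b⦄, IsShortRange α y x b → b ∉ defectSet α y)
    (hxx' : IsShortRange α y x x') : 2 ≤ simplexCount α y x x' := by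
  classical
  have hα1 : α < 1 := by linarith
  obtain ⟨p, hp0, H⟩ := exists_isHexagonalNbhd hα hα' hsep hx hN hxx'
  have hxp : ∀ i, x ≠ p i := fun i => (H.isShortRange_centre i).ne hα1
  have hp01 : p 0 ≠ p 1 := fun h => by have := H.injective h; exact absurd this (by decide)
  have hp05 : p 0 ≠ p 5 := fun h => by have := H.injective h; exact absurd this (by decide)
  have hp15 : p 1 ≠ p 5 := fun h => by have := H.injective h; exact absurd this (by decide)
  have h50 : IsShortRange α y (p 5) (p 0) := by
    have := H.isShortRange_succ 5
    simpa using this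
  have hT₁ : IsEquilateralSimplex α y 1 ({x, p 0, p 1} : Finset (Fin N)) :=
    isEquilateralSimplex_one_triple (hxp 0) (hxp 1) hp01 (H.isShortRange_centre 0)
      (H.isShortRange_centre 1) (H.isShortRange_succ 0)
  have hT₂ : IsEquilateralSimplex α y 1 ({x, p 0, p 5} : Finset (Fin N)) :=
    isEquilateralSimplex_one_triple (hxp 0) (hxp 5) hp05 (H.isShortRange_centre 0)
      (H.isShortRange_centre 5) h50.symm
  have hne : ({x, p 0, p 1} : Finset (Fin N)) ≠ {x, p 0, p 5} := by
    intro h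
    have : p 1 ∈ ({x, p 0, p 5} : Finset (Fin N)) := by
      rw [← h]
      simp
    simp only [Finset.mem_insert, Finset.mem_singleton] at this
    rcases this with h1 | h1 | h1
    · exact hxp 1 h1.symm
    · exact hp01 h1.symm
    · exact hp15 h1
  unfold simplexCount
  rw [← hp0]
  calc 2 = ({({x, p 0, p 1} : Finset (Fin N)), {x, p 0, p 5}} : Finset (Finset (Fin N))).card :=
        (Finset.card_pair hne).symm
    _ ≤ _ := by
        refine Finset.card_le_card ?_
        intro T hT
        simp only [Finset.mem_insert, Finset.mem_singleton] at hT
        rw [Finset.mem_filter, mem_unitSimplices_iff]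
        rcases hT with rfl | rfl
        · exact ⟨hT₁, by simp, by simp⟩
        · exact ⟨hT₂, by simp, by simp⟩

/-! ### `#(𝒮₀ ∪ 𝒮₁) ≤ C #∂X` -/

/-- **Short bonds in fewer than two unit simplices have their first endpoint in `𝒩(∂X)`.**
[cite: Theil2006, §2.4 («The lower bound on the minimum distance (13) implies that #(𝒮₀(y) + 𝒮₁(y)) ≤ C #∂X», preprint p. 11)] -/
theorem fst_mem_defectNbhd_of_simplexCount_lt_two (hα : 0 < α) (hα' : α ≤ 1 / 200)
    (hsep : ∀ i j : Fin N, i ≠ j → 1 - α < dist (y i) (y j)) {p : Fin N × Fin N}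
    (hp : p ∈ shortRangePairs α y) (hlt : simplexCount α y p.1 p.2 < 2) :
    p.1 ∈ defectNbhd α y := by
  classical
  by_contra hnot
  have hpS : IsShortRange α y p.1 p.2 := (mem_shortRangePairs_iff.1 hp).2
  have h1 : p.1 ∉ defects α y := fun h => hnot (Finset.mem_union_left _ h)
  have h1' : p.1 ∉ defectSet α y := by rwa [← coe_defects, Finset.mem_coe]
  have hN : ∀ ⦃b⦄, IsShortRange α y p.1 b → b ∉ defectSet α y := by
    intro b hb hbdef
    rw [← coe_defects, Finset.mem_coe] at hbdef
    apply hnot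
    refine Finset.mem_union_right _ (Finset.mem_biUnion.2 ⟨b, hbdef, ?_⟩)
    exact mem_neighbours_iff.2 hb.symm
  have h2 := two_le_simplexCount hα hα' hsep h1' hN hpS
  omega

/-- **`#(𝒮₀(y) ∪ 𝒮₁(y)) ≤ C #∂X`** with `C = 42`: the short bonds lying in fewer than two unit
simplices number at most `42 #∂X` (each has its first endpoint among the `≤ 7 #∂X` particles of
`𝒩(∂X)`, each of which has `≤ 6` neighbours). Hypotheses: (13) and `0 < α ≤ 1/200`.
[cite: Theil2006, §2.4 («#(𝒮₀(y) + 𝒮₁(y)) ≤ C #∂X», preprint p. 11)] -/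
theorem card_shortRangePairs_simplexCount_lt_two_le (hα : 0 < α) (hα' : α ≤ 1 / 200)
    (hsep : ∀ i j : Fin N, i ≠ j → 1 - α < dist (y i) (y j)) :
    ((shortRangePairs α y).filter fun p => simplexCount α y p.1 p.2 < 2).card ≤
      42 * (defects α y).card := by
  classical
  have hα50 : α ≤ 1 / 50 := by linarith
  set F := (shortRangePairs α y).filter fun p => simplexCount α y p.1 p.2 < 2 with hF
  have hsub : F ⊆ (defectNbhd α y).biUnion fun x => (neighbours α y x).image (Prod.mk x) := by
    intro p hp
    rw [hF, Finset.mem_filter] at hp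
    have h1 := fst_mem_defectNbhd_of_simplexCount_lt_two hα hα' hsep hp.1 hp.2
    refine Finset.mem_biUnion.2 ⟨p.1, h1, Finset.mem_image.2 ⟨p.2, ?_, rfl⟩⟩
    exact mem_neighbours_iff.2 (mem_shortRangePairs_iff.1 hp.1).2
  calc F.card ≤ ((defectNbhd α y).biUnion fun x => (neighbours α y x).image (Prod.mk x)).card :=
        Finset.card_le_card hsub
    _ ≤ ∑ x ∈ defectNbhd α y, ((neighbours α y x).image (Prod.mk x)).card :=
        Finset.card_biUnion_le
    _ ≤ ∑ x ∈ defectNbhd α y, 6 := Finset.sum_le_sum fun x _ =>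
        Finset.card_image_le.trans (card_neighbours_le_six hα hα50 hsep x)
    _ = 6 * (defectNbhd α y).card := by rw [Finset.sum_const, smul_eq_mul, mul_comm]
    _ ≤ 42 * (defects α y).card := by
        have := card_defectNbhd_le hα hα50 hsep (y := y)
        omega

/-- `𝒮₀ ∪ 𝒮₁` is the set of short bonds in fewer than two unit simplices. [cite: Theil2006, §2.3 (preprint p. 9)] -/
theorem shortRangePairsWith_zero_union_one :
    shortRangePairsWith α y 0 ∪ shortRangePairsWith α y 1 =
      (shortRangePairs α y).filter fun p => simplexCount α y p.1 p.2 < 2 := by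
  classical
  ext p
  simp only [Finset.mem_union, mem_shortRangePairsWith_iff, Finset.mem_filter]
  constructor
  · rintro (⟨h, h0⟩ | ⟨h, h1⟩)
    · exact ⟨h, by omega⟩
    · exact ⟨h, by omega⟩
  · rintro ⟨h, hlt⟩
    by_cases h0 : simplexCount α y p.1 p.2 = 0
    · exact Or.inl ⟨h, h0⟩
    · exact Or.inr ⟨h, by omega⟩

/-- **The printed count `#(𝒮₀(y) + 𝒮₁(y)) ≤ C #∂X`** (`C = 42`; (13), `0 < α ≤ 1/200`).
[cite: Theil2006, §2.4 («The lower bound on the minimum distance (13) implies that #(𝒮₀(y) + 𝒮₁(y)) ≤ C #∂X», preprint p. 11)] -/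
theorem card_shortRangePairsWith_zero_add_one_le (hα : 0 < α) (hα' : α ≤ 1 / 200)
    (hsep : ∀ i j : Fin N, i ≠ j → 1 - α < dist (y i) (y j)) :
    (shortRangePairsWith α y 0).card + (shortRangePairsWith α y 1).card ≤
      42 * (defects α y).card := by
  classical
  have hdisj : Disjoint (shortRangePairsWith α y 0) (shortRangePairsWith α y 1) := by
    rw [Finset.disjoint_left]
    intro p h0 h1
    rw [mem_shortRangePairsWith_iff] at h0 h1
    omega
  rw [← Finset.card_union_of_disjoint hdisj, shortRangePairsWith_zero_union_one]
  exact card_shortRangePairs_simplexCount_lt_two_le hα hα' hsep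

/-! ### (38) as printed -/

/-- **Theil 2006, (38)**: there is a universal `C ≥ 0` such that for `0 < α ≤ 1/200`, `V`
satisfying (1)–(5) and every `y : X_N → ℝ²` with (13),
`Σ_{p ∈ 𝒮₀ ∪ 𝒮₁} |e(p) − e_*(p)| ≤ C α #∂X` (`e(p) = V(|y(x) − y(x')|)`,
`e_*(p) = V_*(|y(x) − y(x')|)`): the per-pair bound `|e_*(p) − e(p)| ≤ Cα` of
`Theil2006LongRange.lean` times the count `#(𝒮₀ ∪ 𝒮₁) ≤ 42 #∂X`.
[cite: Theil2006, §2.4 (38) (preprint pp. 11–12)] -/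
theorem exists_sum_abs_sub_le_card_defects :
    ∃ C : ℝ, 0 ≤ C ∧ ∀ ⦃α : ℝ⦄ ⦃V : ℝ → ℝ⦄, 0 < α → α ≤ 1 / 200 → IsAdmissible α V →
      ∀ {N : ℕ} (y : Fin N → Plane), (∀ i j : Fin N, i ≠ j → 1 - α < dist (y i) (y j)) →
        ∑ p ∈ shortRangePairsWith α y 0 ∪ shortRangePairsWith α y 1,
            |V (dist (y p.1) (y p.2)) - renormalizedPotential V (dist (y p.1) (y p.2))| ≤
          C * α * (defects α y).card := by
  classical
  obtain ⟨C, hC, h⟩ := exists_sum_abs_sub_renormalizedPotential_le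
  refine ⟨42 * C, by positivity, fun α V hα hα' hV N y hsep => ?_⟩
  have hP : shortRangePairsWith α y 0 ∪ shortRangePairsWith α y 1 ⊆ shortRangePairs α y := by
    rw [shortRangePairsWith_zero_union_one]
    exact Finset.filter_subset _ _
  have h1 := h (by linarith : α ≤ 1 / 5) hV y _ hP
  have hcount : (((shortRangePairsWith α y 0 ∪ shortRangePairsWith α y 1).card : ℕ) : ℝ) ≤
      42 * (defects α y).card := by
    rw [shortRangePairsWith_zero_union_one]
    exact_mod_cast card_shortRangePairs_simplexCount_lt_two_le hα hα' hsep
  calc _ ≤ C * α * ((shortRangePairsWith α y 0 ∪ shortRangePairsWith α y 1).card : ℝ) := h1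
    _ ≤ C * α * (42 * (defects α y).card) :=
        mul_le_mul_of_nonneg_left hcount (mul_nonneg hC hα.le)
    _ = 42 * C * α * (defects α y).card := by ring

/-! ### A short bond lies in at most two unit simplices ((13); the apex argument) -/

section Apex

/-- `‖v‖² = v₀² + v₁²` in `ℝ²`. [folklore] -/
private theorem norm_sq_plane (v : Plane) : ‖v‖ ^ 2 = v 0 ^ 2 + v 1 ^ 2 := by
  rw [EuclideanSpace.norm_sq_eq, Fin.sum_univ_two, Real.norm_eq_abs, Real.norm_eq_abs, sq_abs,
    sq_abs]

/-- **The normal component of an apex is not small.** In terms of `R₂ = |u|²`, `S = |v|²`,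
`P = ⟨v, u⟩`, `Q = det(u, v)` (so `S R₂ = P² + Q²`, `|v − u|² = S − 2P + R₂`): if
`|u|², |v|², |v − u|² ∈ [(1−α)², (1+α)²]` and `α ≤ 1/20` then `Q² ≥ ¼`.
[cite: Theil2006, §4.2 proof of Lemma 4.7 (the apex argument, preprint p. 20); our lemma] -/
theorem quarter_le_normal_sq {α R₂ S P Q : ℝ} (hα0 : 0 ≤ α) (hα : α ≤ 1 / 20)
    (hR1 : (1 - α) ^ 2 ≤ R₂) (hR2 : R₂ ≤ (1 + α) ^ 2) (hS1 : (1 - α) ^ 2 ≤ S)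
    (hD1 : (1 - α) ^ 2 ≤ S - 2 * P + R₂) (hD2 : S - 2 * P + R₂ ≤ (1 + α) ^ 2)
    (hS2 : S ≤ (1 + α) ^ 2) (hLag : S * R₂ = P ^ 2 + Q ^ 2) : 1 / 4 ≤ Q ^ 2 := by
  have hα2 : α ^ 2 ≤ α / 20 := by nlinarith [mul_nonneg hα0 (by linarith : 0 ≤ 1 / 20 - α)]
  have hαsq := sq_nonneg α
  have hR2l : 9 / 10 ≤ R₂ := by linarith
  have hR2u : R₂ ≤ 111 / 100 := by linarith
  have hR20 : 0 ≤ R₂ := by linarith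
  have hP1 : P ≤ R₂ / 2 + 2 * α := by linarith
  have hP2 : R₂ / 2 - 2 * α ≤ P := by linarith
  have hP0 : 0 ≤ P := by linarith
  have hbr : 1 / 2 ≤ (1 - α) ^ 2 - R₂ / 4 - 2 * α := by linarith
  have h2 : P ^ 2 ≤ (R₂ / 2 + 2 * α) ^ 2 := pow_le_pow_left₀ hP0 hP1 2
  have h3 : (1 - α) ^ 2 * R₂ ≤ S * R₂ := mul_le_mul_of_nonneg_right hS1 hR20
  have h4 : 9 / 10 * (1 / 2) ≤ R₂ * ((1 - α) ^ 2 - R₂ / 4 - 2 * α) :=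
    mul_le_mul hR2l hbr (by norm_num) hR20
  linarith

/-- **The apex computation.** With `R₂ = |u|²`, `S = |v|²`, `S' = |w|²`, `P = ⟨v,u⟩`,
`P' = ⟨w,u⟩`, `Q = det(u,v)`, `Q' = det(u,w)`: if `|u|², |v|², |v−u|², |w|², |w−u|²` all lie in
`[(1−α)², (1+α)²]`, `α ≤ 1/20`, and `Q Q' > 0` (same side), then
`(P − P')² + (Q − Q')² < (1 − α)² R₂`, i.e. `|v − w| < 1 − α`.
[cite: Theil2006, §4.2 proof of Lemma 4.7 (the apex argument, preprint p. 20); our lemma] -/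
theorem apex_abstract {α R₂ S S' P P' Q Q' : ℝ} (hα0 : 0 ≤ α) (hα : α ≤ 1 / 20)
    (hR1 : (1 - α) ^ 2 ≤ R₂) (hR2 : R₂ ≤ (1 + α) ^ 2)
    (hS1 : (1 - α) ^ 2 ≤ S) (hS2 : S ≤ (1 + α) ^ 2)
    (hD1 : (1 - α) ^ 2 ≤ S - 2 * P + R₂) (hD2 : S - 2 * P + R₂ ≤ (1 + α) ^ 2)
    (hS1' : (1 - α) ^ 2 ≤ S') (hS2' : S' ≤ (1 + α) ^ 2)
    (hD1' : (1 - α) ^ 2 ≤ S' - 2 * P' + R₂) (hD2' : S' - 2 * P' + R₂ ≤ (1 + α) ^ 2)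
    (hLag : S * R₂ = P ^ 2 + Q ^ 2) (hLag' : S' * R₂ = P' ^ 2 + Q' ^ 2) (hsign : 0 < Q * Q') :
    (P - P') ^ 2 + (Q - Q') ^ 2 < (1 - α) ^ 2 * R₂ := by
  have hα2 : α ^ 2 ≤ α / 20 := by nlinarith [mul_nonneg hα0 (by linarith : 0 ≤ 1 / 20 - α)]
  have hαsq := sq_nonneg α
  have hR2l : 9 / 10 ≤ R₂ := by linarith
  have hR2u : R₂ ≤ 111 / 100 := by linarith
  have hR20 : 0 ≤ R₂ := by linarith
  have hP1 : P ≤ R₂ / 2 + 2 * α := by linarith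
  have hP2 : R₂ / 2 - 2 * α ≤ P := by linarith
  have hP1' : P' ≤ R₂ / 2 + 2 * α := by linarith
  have hP2' : R₂ / 2 - 2 * α ≤ P' := by linarith
  have hQ2 : 1 / 4 ≤ Q ^ 2 := quarter_le_normal_sq hα0 hα hR1 hR2 hS1 hD1 hD2 hS2 hLag
  have hQ2' : 1 / 4 ≤ Q' ^ 2 := quarter_le_normal_sq hα0 hα hR1 hR2 hS1' hD1' hD2' hS2' hLag'
  have hsum : 1 / 2 ≤ (Q + Q') ^ 2 := by
    have e : (Q + Q') ^ 2 = Q ^ 2 + 2 * (Q * Q') + Q' ^ 2 := by ring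
    rw [e]; linarith
  -- `|Q² − Q'²| ≤ 10 α`
  have hdiff : Q ^ 2 - Q' ^ 2 = (S - S') * R₂ - (P - P') * (P + P') := by
    linear_combination (-1 : ℝ) * hLag + hLag'
  have hSS : S - S' ≤ 4 * α := by linarith
  have hSS' : -(4 * α) ≤ S - S' := by linarith
  have hA1 : (S - S') * R₂ ≤ 4 * α * R₂ := mul_le_mul_of_nonneg_right hSS hR20
  have hA1' : -(4 * α) * R₂ ≤ (S - S') * R₂ := mul_le_mul_of_nonneg_right hSS' hR20
  have hA1u : 4 * α * R₂ ≤ 4 * α * (111 / 100) := mul_le_mul_of_nonneg_left hR2u (by linarith)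
  have hPP1 : P - P' ≤ 4 * α := by linarith
  have hPP1' : -(4 * α) ≤ P - P' := by linarith
  have hPP0 : 0 ≤ P + P' := by linarith
  have hPPu : P + P' ≤ 131 / 100 := by linarith
  have hA2 : (P - P') * (P + P') ≤ 4 * α * (P + P') := mul_le_mul_of_nonneg_right hPP1 hPP0
  have hA2' : -(4 * α) * (P + P') ≤ (P - P') * (P + P') := mul_le_mul_of_nonneg_right hPP1' hPP0
  have hA2u : 4 * α * (P + P') ≤ 4 * α * (131 / 100) := mul_le_mul_of_nonneg_left hPPu (by linarith)
  have hQQ1 : Q ^ 2 - Q' ^ 2 ≤ 10 * α := by linarith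
  have hQQ2 : -(10 * α) ≤ Q ^ 2 - Q' ^ 2 := by linarith
  -- `(Q − Q')² ≤ 200 α²`, `(P − P')² ≤ 16 α²`
  have hQd : (Q - Q') ^ 2 ≤ 200 * α ^ 2 := by
    have h1 : (Q - Q') ^ 2 * (Q + Q') ^ 2 = (Q ^ 2 - Q' ^ 2) ^ 2 := by ring
    have h2 : (Q ^ 2 - Q' ^ 2) ^ 2 ≤ (10 * α) ^ 2 := sq_le_sq' hQQ2 hQQ1
    have h3 : (Q - Q') ^ 2 * (1 / 2) ≤ (Q - Q') ^ 2 * (Q + Q') ^ 2 :=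
      mul_le_mul_of_nonneg_left hsum (sq_nonneg _)
    rw [h1] at h3
    linarith
  have hPd : (P - P') ^ 2 ≤ (4 * α) ^ 2 := sq_le_sq' hPP1' hPP1
  -- conclusion: `216 α² < (1 − α)² R₂`
  have hk : (1 - 2 * α) * (9 / 10) ≤ (1 - α) ^ 2 * R₂ :=
    mul_le_mul (by linarith) hR2l (by norm_num) (sq_nonneg _)
  nlinarith

/-- Squared distance windows in coordinates. [folklore] -/
private theorem sq_window_plane {α : ℝ} (hα1 : 0 ≤ 1 - α) {p q : Plane}
    (h : 1 - α ≤ dist p q ∧ dist p q ≤ 1 + α) :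
    (1 - α) ^ 2 ≤ (p 0 - q 0) ^ 2 + (p 1 - q 1) ^ 2 ∧
      (p 0 - q 0) ^ 2 + (p 1 - q 1) ^ 2 ≤ (1 + α) ^ 2 := by
  have e : (p 0 - q 0) ^ 2 + (p 1 - q 1) ^ 2 = dist p q ^ 2 := by
    rw [dist_eq_norm, norm_sq_plane]
    simp only [PiLp.sub_apply]
  rw [e]
  exact ⟨pow_le_pow_left₀ hα1 h.1 2, pow_le_pow_left₀ dist_nonneg h.2 2⟩

/-- **Two particles forming near-unit triangles with the same bond, on the same side of it, are
closer than `1 − α`** (`α ≤ 1/20`): for `a, b, z, z' ∈ ℝ²` with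
`|a − b|, |z − a|, |z − b|, |z' − a|, |z' − b| ∈ [1 − α, 1 + α]` and
`det(b − a, z − a) · det(b − a, z' − a) > 0`, `|z − z'| < 1 − α`.
[cite: Theil2006, §4.2 proof of Lemma 4.7 (apex argument, preprint p. 20); our lemma] -/
theorem dist_lt_of_same_side {α : ℝ} (hα0 : 0 ≤ α) (hα : α ≤ 1 / 20) {a b z z' : Plane}
    (hab : 1 - α ≤ dist a b ∧ dist a b ≤ 1 + α) (hza : 1 - α ≤ dist z a ∧ dist z a ≤ 1 + α)
    (hzb : 1 - α ≤ dist z b ∧ dist z b ≤ 1 + α) (hz'a : 1 - α ≤ dist z' a ∧ dist z' a ≤ 1 + α)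
    (hz'b : 1 - α ≤ dist z' b ∧ dist z' b ≤ 1 + α)
    (hside : 0 < det₂ (b - a) (z - a) * det₂ (b - a) (z' - a)) : dist z z' < 1 - α := by
  have hα1 : 0 ≤ 1 - α := by linarith
  have hu := sq_window_plane hα1 (p := b) (q := a) (by rwa [dist_comm] at hab)
  have hv := sq_window_plane hα1 hza
  have hvu := sq_window_plane hα1 hzb
  have hw := sq_window_plane hα1 hz'a
  have hwu := sq_window_plane hα1 hz'b
  -- coordinates relative to `a`
  set u0 := b 0 - a 0 with hu0
  set u1 := b 1 - a 1 with hu1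
  set v0 := z 0 - a 0 with hv0
  set v1 := z 1 - a 1 with hv1
  set w0 := z' 0 - a 0 with hw0
  set w1 := z' 1 - a 1 with hw1
  have e1 : (z 0 - b 0) ^ 2 + (z 1 - b 1) ^ 2 =
      (v0 ^ 2 + v1 ^ 2) - 2 * (v0 * u0 + v1 * u1) + (u0 ^ 2 + u1 ^ 2) := by
    simp only [hu0, hu1, hv0, hv1]; ring
  have e2 : (z' 0 - b 0) ^ 2 + (z' 1 - b 1) ^ 2 =
      (w0 ^ 2 + w1 ^ 2) - 2 * (w0 * u0 + w1 * u1) + (u0 ^ 2 + u1 ^ 2) := by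
    simp only [hu0, hu1, hw0, hw1]; ring
  rw [e1] at hvu
  rw [e2] at hwu
  have hLag : (v0 ^ 2 + v1 ^ 2) * (u0 ^ 2 + u1 ^ 2) =
      (v0 * u0 + v1 * u1) ^ 2 + (u0 * v1 - u1 * v0) ^ 2 := by ring
  have hLag' : (w0 ^ 2 + w1 ^ 2) * (u0 ^ 2 + u1 ^ 2) =
      (w0 * u0 + w1 * u1) ^ 2 + (u0 * w1 - u1 * w0) ^ 2 := by ring
  have hside' : 0 < (u0 * v1 - u1 * v0) * (u0 * w1 - u1 * w0) := by
    simpa [det₂, PiLp.sub_apply, hu0, hu1, hv0, hv1, hw0, hw1] using hside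
  have key := apex_abstract hα0 hα hu.1 hu.2 hv.1 hv.2 hvu.1 hvu.2 hw.1 hw.2 hwu.1 hwu.2
    hLag hLag' hside'
  -- `|z − z'|² R₂ = (P − P')² + (Q − Q')²`
  have hLagD : ((z 0 - z' 0) ^ 2 + (z 1 - z' 1) ^ 2) * (u0 ^ 2 + u1 ^ 2) =
      (v0 * u0 + v1 * u1 - (w0 * u0 + w1 * u1)) ^ 2 +
        (u0 * v1 - u1 * v0 - (u0 * w1 - u1 * w0)) ^ 2 := by
    have f0 : z 0 - z' 0 = v0 - w0 := by simp only [hv0, hw0]; ring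
    have f1 : z 1 - z' 1 = v1 - w1 := by simp only [hv1, hw1]; ring
    rw [f0, f1]; ring
  have hR20 : 0 < u0 ^ 2 + u1 ^ 2 := by
    have : (0 : ℝ) < (1 - α) ^ 2 := by
      have : 0 < 1 - α := by linarith
      positivity
    linarith [hu.1]
  have hsq : (z 0 - z' 0) ^ 2 + (z 1 - z' 1) ^ 2 < (1 - α) ^ 2 := by
    by_contra hge
    rw [not_lt] at hge
    have := mul_le_mul_of_nonneg_right hge hR20.le
    rw [hLagD] at this
    linarith
  have e3 : dist z z' ^ 2 = (z 0 - z' 0) ^ 2 + (z 1 - z' 1) ^ 2 := by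
    rw [dist_eq_norm, norm_sq_plane]
    simp only [PiLp.sub_apply]
  by_contra hge
  rw [not_lt] at hge
  have := pow_le_pow_left₀ hα1 hge 2
  linarith

/-- The determinant `det(b − a, z − a)` of a common near-unit neighbour `z` of a near-unit bond
`{a, b}` is nonzero (`α ≤ 1/20`). [cite: Theil2006, §4.2 proof of Lemma 4.7 (preprint p. 20); our lemma] -/
theorem det₂_ne_zero_of_near_unit {α : ℝ} (hα0 : 0 ≤ α) (hα : α ≤ 1 / 20) {a b z : Plane}
    (hab : 1 - α ≤ dist a b ∧ dist a b ≤ 1 + α) (hza : 1 - α ≤ dist z a ∧ dist z a ≤ 1 + α)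
    (hzb : 1 - α ≤ dist z b ∧ dist z b ≤ 1 + α) : det₂ (b - a) (z - a) ≠ 0 := by
  have hα1 : 0 ≤ 1 - α := by linarith
  have hu := sq_window_plane hα1 (p := b) (q := a) (by rwa [dist_comm] at hab)
  have hv := sq_window_plane hα1 hza
  have hvu := sq_window_plane hα1 hzb
  set u0 := b 0 - a 0 with hu0
  set u1 := b 1 - a 1 with hu1
  set v0 := z 0 - a 0 with hv0
  set v1 := z 1 - a 1 with hv1
  have e1 : (z 0 - b 0) ^ 2 + (z 1 - b 1) ^ 2 =
      (v0 ^ 2 + v1 ^ 2) - 2 * (v0 * u0 + v1 * u1) + (u0 ^ 2 + u1 ^ 2) := by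
    simp only [hu0, hu1, hv0, hv1]; ring
  rw [e1] at hvu
  have hLag : (v0 ^ 2 + v1 ^ 2) * (u0 ^ 2 + u1 ^ 2) =
      (v0 * u0 + v1 * u1) ^ 2 + (u0 * v1 - u1 * v0) ^ 2 := by ring
  have key := quarter_le_normal_sq hα0 hα hu.1 hu.2 hv.1 hvu.1 hvu.2 hv.2 hLag
  intro h0
  have h0' : u0 * v1 - u1 * v0 = 0 := by
    simpa [det₂, PiLp.sub_apply, hu0, hu1, hv0, hv1] using h0
  rw [h0'] at key
  norm_num at key

/-- **A short bond has at most two common `𝒮`-neighbours** under (13), `0 < α ≤ 1/20`: the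
common neighbours lie near the two apexes, at most one near each (two on one side would be
closer than `1 − α`, `dist_lt_of_same_side`). [cite: Theil2006, §2.3 («Proposition 2.8.1 implies that 𝒫 = ⋃_j (𝒮_j(y) ∪ ℒ_j(y))», preprint p. 9) and §4.2 Lemma 4.7 (p. 20); our lemma] -/
theorem card_common_neighbours_le_two (hα : 0 < α) (hα' : α ≤ 1 / 20)
    (hsep : ∀ i j : Fin N, i ≠ j → 1 - α < dist (y i) (y j)) {x x' : Fin N}
    (hxx' : IsShortRange α y x x') :
    (neighbours α y x ∩ neighbours α y x').card ≤ 2 := by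
  classical
  by_contra hlt
  rw [not_le, Finset.two_lt_card_iff] at hlt
  obtain ⟨z₁, z₂, z₃, h₁, h₂, h₃, h12, h13, h23⟩ := hlt
  simp only [Finset.mem_inter, mem_neighbours_iff] at h₁ h₂ h₃
  have win : ∀ {i j : Fin N}, IsShortRange α y i j →
      1 - α ≤ dist (y j) (y i) ∧ dist (y j) (y i) ≤ 1 + α := by
    intro i j h
    rw [dist_comm]
    exact ⟨h.le_dist, h.dist_le⟩
  have hab : 1 - α ≤ dist (y x) (y x') ∧ dist (y x) (y x') ≤ 1 + α :=
    ⟨hxx'.le_dist, hxx'.dist_le⟩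
  have hd0 : ∀ {z}, IsShortRange α y x z → IsShortRange α y x' z →
      det₂ (y x' - y x) (y z - y x) ≠ 0 := fun h h' =>
    det₂_ne_zero_of_near_unit hα.le hα' hab (win h) (win h')
  have hclose : ∀ {z z'}, IsShortRange α y x z → IsShortRange α y x' z →
      IsShortRange α y x z' → IsShortRange α y x' z' →
        0 < det₂ (y x' - y x) (y z - y x) * det₂ (y x' - y x) (y z' - y x) → z = z' := by
    intro z z' hz hz' hw hw' hs
    by_contra hne
    have h := dist_lt_of_same_side hα.le hα' hab (win hz) (win hz') (win hw) (win hw') hs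
    exact absurd (hsep z z' hne) (not_lt.2 h.le)
  have hd1 := hd0 h₁.1 h₁.2
  have hd2 := hd0 h₂.1 h₂.2
  have hd3 := hd0 h₃.1 h₃.2
  rcases lt_or_gt_of_ne hd1 with s1 | s1 <;> rcases lt_or_gt_of_ne hd2 with s2 | s2
  · exact h12 (hclose h₁.1 h₁.2 h₂.1 h₂.2 (mul_pos_of_neg_of_neg s1 s2))
  · rcases lt_or_gt_of_ne hd3 with s3 | s3
    · exact h13 (hclose h₁.1 h₁.2 h₃.1 h₃.2 (mul_pos_of_neg_of_neg s1 s3))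
    · exact h23 (hclose h₂.1 h₂.2 h₃.1 h₃.2 (mul_pos s2 s3))
  · rcases lt_or_gt_of_ne hd3 with s3 | s3
    · exact h23 (hclose h₂.1 h₂.2 h₃.1 h₃.2 (mul_pos_of_neg_of_neg s2 s3))
    · exact h13 (hclose h₁.1 h₁.2 h₃.1 h₃.2 (mul_pos s1 s3))
  · exact h12 (hclose h₁.1 h₁.2 h₂.1 h₂.2 (mul_pos s1 s2))

/-- **A short bond lies in at most two unit simplices** ((13), `0 < α ≤ 1/20`): the third vertex
of a unit simplex through `{x, x'}` is a common `𝒮`-neighbour, and there are at most two.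
[cite: Theil2006, §2.3 («Proposition 2.8.1 implies that 𝒫 = ⋃_{j=0}^{2} (𝒮_j(y) ∪ ℒ_j(y))», preprint p. 9); our lemma] -/
theorem simplexCount_le_two (hα : 0 < α) (hα' : α ≤ 1 / 20)
    (hsep : ∀ i j : Fin N, i ≠ j → 1 - α < dist (y i) (y j)) {x x' : Fin N}
    (hxx' : IsShortRange α y x x') : simplexCount α y x x' ≤ 2 := by
  classical
  have hα1 : α < 1 := by linarith
  have hne : x ≠ x' := hxx'.ne hα1
  unfold simplexCount
  refine le_trans ?_ (card_common_neighbours_le_two hα hα' hsep hxx')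
  -- every simplex through `{x, x'}` is `{x, x', z}` for a common neighbour `z`
  have hsub : ((unitSimplices α y).filter fun T => x ∈ T ∧ x' ∈ T) ⊆
      (neighbours α y x ∩ neighbours α y x').image fun z => ({x, x', z} : Finset (Fin N)) := by
    intro T hT
    rw [Finset.mem_filter, mem_unitSimplices_iff, isEquilateralSimplex_one_iff] at hT
    obtain ⟨⟨hcard, hpairs⟩, hxT, hx'T⟩ := hT
    have hsub2 : ({x, x'} : Finset (Fin N)) ⊆ T := by
      intro w hw
      simp only [Finset.mem_insert, Finset.mem_singleton] at hw
      rcases hw with rfl | rfl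
      · exact hxT
      · exact hx'T
    have hcard2 : ({x, x'} : Finset (Fin N)).card = 2 := Finset.card_pair hne
    have hcard1 : (T \ {x, x'}).card = 1 := by
      rw [Finset.card_sdiff_of_subset hsub2, hcard, hcard2]
    obtain ⟨z, hz⟩ := Finset.card_eq_one.1 hcard1
    have hzT : z ∈ T \ {x, x'} := by rw [hz]; exact Finset.mem_singleton_self z
    rw [Finset.mem_sdiff] at hzT
    obtain ⟨hzT, hzxx⟩ := hzT
    simp only [Finset.mem_insert, Finset.mem_singleton, not_or] at hzxx
    refine Finset.mem_image.2 ⟨z, ?_, ?_⟩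
    · rw [Finset.mem_inter, mem_neighbours_iff, mem_neighbours_iff]
      exact ⟨hpairs x hxT z hzT (Ne.symm hzxx.1), hpairs x' hx'T z hzT (Ne.symm hzxx.2)⟩
    · rw [← Finset.union_sdiff_of_subset hsub2, hz]
      ext w
      simp only [Finset.mem_union, Finset.mem_insert, Finset.mem_singleton]
      tauto
  exact (Finset.card_le_card hsub).trans Finset.card_image_le

/-- **`𝒮 = 𝒮₀ ∪ 𝒮₁ ∪ 𝒮₂`** — the short-range half of «Proposition 2.8.1 implies that
`𝒫 = ⋃_{j=0}^{2} (𝒮_j(y) ∪ ℒ_j(y))`» ((13), `0 < α ≤ 1/20`).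
[cite: Theil2006, §2.3 (preprint p. 9); our lemma] -/
theorem shortRangePairs_eq_union (hα : 0 < α) (hα' : α ≤ 1 / 20)
    (hsep : ∀ i j : Fin N, i ≠ j → 1 - α < dist (y i) (y j)) :
    shortRangePairs α y =
      shortRangePairsWith α y 0 ∪ shortRangePairsWith α y 1 ∪ shortRangePairsWith α y 2 := by
  classical
  ext p
  simp only [Finset.mem_union, mem_shortRangePairsWith_iff]
  constructor
  · intro hp
    have h2 := simplexCount_le_two hα hα' hsep (mem_shortRangePairs_iff.1 hp).2
    rcases Nat.lt_or_ge (simplexCount α y p.1 p.2) 2 with h | h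
    · rcases Nat.lt_or_ge (simplexCount α y p.1 p.2) 1 with h' | h'
      · exact Or.inl (Or.inl ⟨hp, by omega⟩)
      · exact Or.inl (Or.inr ⟨hp, by omega⟩)
    · exact Or.inr ⟨hp, by omega⟩
  · rintro ((⟨hp, -⟩ | ⟨hp, -⟩) | ⟨hp, -⟩) <;> exact hp

/-- **Off `𝒩(∂X)` every short bond lies in exactly two unit simplices** (`{x, x'} ∈ 𝒮₂`):
`two_le_simplexCount` and `simplexCount_le_two` ((13), `0 < α ≤ 1/200`).
[cite: Theil2006, §2.3 (𝒮_j, preprint p. 9) and §4.2 Lemma 4.7 (p. 20); our lemma] -/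
theorem simplexCount_eq_two (hα : 0 < α) (hα' : α ≤ 1 / 200)
    (hsep : ∀ i j : Fin N, i ≠ j → 1 - α < dist (y i) (y j)) {x x' : Fin N}
    (hx : x ∉ defectSet α y) (hN : ∀ ⦃b⦄, IsShortRange α y x b → b ∉ defectSet α y)
    (hxx' : IsShortRange α y x x') : simplexCount α y x x' = 2 :=
  le_antisymm (simplexCount_le_two hα (by linarith) hsep hxx') (two_le_simplexCount hα hα' hsep hx hN hxx')

end Apex

end Theil2006

end Literature.MathematicalPhysics.StatisticalMechanics

end
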